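import Literature.Analysis.FluidPDE.Seregin2023.PolynomialScenarioExcluded
import HarnessLib

/-!
# Seregin 2026, Thm 3.1 at the power weight `f(r) = r^ρ`, `(s, l, κ, η) = (3, 3, 2, 0)`:
# the hypotheses and the non-triviality clause in CKN-gauge form (all proved)

Analysis/FluidPDE proof file (no definitions, no named facts, no `sorry`), companion of
`TypeIIEulerZoomScenario.lean` (the named fact
`Literature.Analysis.FluidPDE.Seregin2023.seregin2026_typeII_scenario_eulerLimit` = G. Seregin,
*On potential Type II blowups for the Navier–Stokes equations*, arXiv:2606.29468, **Thm 3.1**, in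
the general `(s, l, η)` frame with an admissible weight `f` and its limit ratio `F`) and of
`PolynomialScenarioExcluded.lean` (`kappa_three_three`, `pEta_zero`, `qEta_zero`,
`isScenarioWeight_rpow`). It specialises the HYPOTHESES of Thm 3.1 to the case the §B route
`EulerZoomLiouville` of the summit NavierStokesRegularity imports (its support item
`SereginZoomReduction`, stmt-NavierStokesRegularity-19834: "Seregin2026 Thm 3.1 at
`(s,l,κ,η) = (3,3,2,0)`, `f(r) = r^ρ`, `0 < ρ ≤ 1/2` so that (3.3) holds with
`κ₁ = ρ(17/20 − ρ) > 0`"), where the scenario is written with the Caffarelli–Kohn–Nirenberg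
quantities `cknA`, `cknE`, `cknD` and the floor (3.1) as a space–time integral over the windows
`]t₀ − r^{2+ρ}, t₀[ × B(x₀, r)`:

* (d) `params_three_three_zero` — the standing restrictions (1.4), (2.3) at `(3,3,0)`;
  `growthCondition_rpow` — **(3.3) for `f = r^ρ`**: the ratio
  `f(λ)^{(l/2)(1+3/p(0))}/f(λ√f(λ))^{l−1}` is `λ^{ρ(17/20 − ρ)}`, bounded near `0⁺` iff `ρ ≤ 17/20`.
* (b) `hasWeightedEnergyBound_rpow_of_gauge` — **(1.7) from the CKN form**: the power-gauged bound
  `r^{2ρ} A(r) + r^{ρ} E(r) + r^{2ρ} D(r) ≤ M` on `]0,1]` (with `cknA` a genuine supremum in time)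
  implies `HasWeightedEnergyBound (r ↦ r^ρ) M` (`A_f ≤ r^{2ρ}A` since `ess sup ≤ sup`;
  `E_f = r^ρ E`, `D_f = r^{2ρ} D` identically).
* (c) `rpow_mul_morreyMbar_rpow_eq` — **the floor dictionary**:
  `f(r)^{l−1} M̄^{3,3}_2(v,r) = r^{2ρ−2} ∫_{]t₀−r^{2+ρ},t₀[ × B(x₀,r)} |v|³` (Tonelli; `l/s = 1`,
  `r²f(r) = r^{2+ρ}`); `exists_floor_seq` — from "`∀ δ > 0, ∃ r ∈ ]0,δ[` with the floor" to
  Seregin's strictly decreasing null sequence `r_k` with `ε₀ ≤ f(r_k)^{l−1} M̄(v, r_k)`.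
* (f) `not_ae_eq_zero_of_morreyM_ge` — **the non-triviality clause (3.8)**
  `M^{3,3}_2(u,1) ≥ ε₀/2 > 0` forbids `u = 0` a.e. on `]-∞,0[ × ℝ³`.

What a by-name reduction `(h : seregin2026_typeII_scenario_eulerLimit) → SereginZoomReduction`
still needs (prover work, Summits-side; recorded here for the seat that takes 19834):
(a) Navier–Stokes rescaling/translation of `IsSuitableWeakSolutionInBall r₀ z₀`, the weak gradient
and the gauges to the unit cylinder `Q(0,1)` (the weights pick up constants `r₀^{2ρ}`, `r₀^{ρ}`);
(e) on the conclusion side, assembling `IsSuitableWeakSolutionOn (slab ]-∞,0[) 0 0 u p` from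
(3.5)–(3.7) (energy class and `L^{3/2}_loc` pressure from (3.5); the integrated local energy
inequality from the slice form (3.7) at an a.e. time beyond the support of the test function;
Fubini via the local integrability in `IsDistributionalEulerSolutionOn`), and passing from the
a.e.-in-time `A`-bound of (3.5) (essential supremum) to the pointwise supremum `cknA` of the route
decl by re-defining `u` on a null set of times (all other clauses are a.e.-stable).

Nothing here is new mathematics; nothing here bears on Navier–Stokes regularity.
-/

noncomputable section

open MeasureTheory Set Filter Topology Metric Function
open scoped ENNReal NNReal

namespace Literature.Analysis.FluidPDE.Seregin2023

/-! ### (d) Parameters `(s, l, κ, η) = (3, 3, 2, 0)` and the growth condition (3.3) for `f = r^ρ` -/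

/-- The standing restrictions (1.4), (2.3) of Seregin 2026 at `(s, l, η) = (3, 3, 0)`:
`1 < 3`, `0 < κ(3,3) = 2 < 3`, `0 ∈ [0,1]`, `3 < p(0) = 10/3`, `3 < q(0) = 10/3`.
[cite: Seregin2026, (1.4) (p. 3) and (2.3) (p. 5)] -/
theorem params_three_three_zero :
    (1 : ℝ) < 3 ∧ 0 < kappa 3 3 ∧ kappa 3 3 < 3 ∧ (0 : ℝ) ∈ Icc (0 : ℝ) 1 ∧
      (3 : ℝ) < pEta 0 ∧ (3 : ℝ) < qEta 0 := by
  rw [kappa_three_three, pEta_zero, qEta_zero]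
  norm_num

/-- **The growth condition (3.3) for the power weight.** With `f(λ) = λ^ρ`, `l = 3` and
`p(0) = 10/3`, the ratio `f(λ)^{(l/2)(1+3/p(0))} / f(λ√f(λ))^{l-1}` equals `λ^{ρ(17/20 - ρ)}`,
which stays bounded as `λ → 0⁺` exactly when `ρ ≤ 17/20` (in particular for `0 < ρ ≤ 1/2`); the
bound `C = 1` works on `]0,1[`. Stated in the literal shape of the (3.3)-hypothesis of
`seregin2026_typeII_scenario_eulerLimit` at `l = 3`, `η = 0`. [cite: Seregin2026, (3.3) (p. 9)] -/
theorem growthCondition_rpow {ρ : ℝ} (hρ : 0 < ρ) (hρ' : ρ ≤ 17 / 20) :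
    ∃ C : ℝ, ∀ᶠ lam in 𝓝[>] (0 : ℝ),
      (lam ^ ρ) ^ ((3 : ℝ) / 2 * (1 + 3 / pEta 0)) /
          ((lam * Real.sqrt (lam ^ ρ)) ^ ρ) ^ ((3 : ℝ) - 1) ≤ C := by
  refine ⟨1, ?_⟩
  have hmem : Ioo (0 : ℝ) 1 ∈ 𝓝[>] (0 : ℝ) := Ioo_mem_nhdsGT one_pos
  filter_upwards [hmem] with lam hlam
  have hl : 0 < lam := hlam.1
  have hl1 : lam ≤ 1 := hlam.2.le
  rw [pEta_zero]
  -- numerator `= lam ^ (57ρ/20)`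
  have hnum : (lam ^ ρ) ^ ((3 : ℝ) / 2 * (1 + 3 / (10 / 3))) = lam ^ (ρ * (57 / 20)) := by
    rw [← Real.rpow_mul hl.le]
    norm_num
  -- denominator `= lam ^ (2ρ + ρ²)`
  have hsqrt : Real.sqrt (lam ^ ρ) = lam ^ (ρ / 2) := by
    rw [Real.sqrt_eq_rpow, ← Real.rpow_mul hl.le]
    ring_nf
  have hden : ((lam * Real.sqrt (lam ^ ρ)) ^ ρ) ^ ((3 : ℝ) - 1) = lam ^ (2 * ρ + ρ ^ 2) := by
    rw [hsqrt, ← Real.rpow_one_add' hl.le (by positivity), ← Real.rpow_mul hl.le,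
      ← Real.rpow_mul hl.le]
    ring_nf
  rw [hnum, hden, ← Real.rpow_sub hl]
  have hexp : 0 ≤ ρ * (57 / 20) - (2 * ρ + ρ ^ 2) := by nlinarith
  exact Real.rpow_le_one hl.le hl1 hexp

/-! ### (b) The gauge bound: from the CKN `sup`-quantities with power weights to `A_f + E_f + D_f` -/

/-- `ofReal ((r^ρ)²/r) = ofReal (r^{2ρ}) · (ofReal r)⁻¹` for `r > 0`. [folklore] -/
private theorem ofReal_rpow_sq_div {ρ r : ℝ} (hr : 0 < r) :
    ENNReal.ofReal ((r ^ ρ) ^ 2 / r) = ENNReal.ofReal (r ^ (2 * ρ)) * (ENNReal.ofReal r)⁻¹ := by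
  rw [div_eq_mul_inv, ENNReal.ofReal_mul (by positivity), ENNReal.ofReal_inv_of_pos hr,
    ← Real.rpow_natCast (r ^ ρ) 2, ← Real.rpow_mul hr.le, mul_comm ρ]
  norm_num

/-- `ofReal (r^ρ/r) = ofReal (r^{ρ}) · (ofReal r)⁻¹` for `r > 0`. [folklore] -/
private theorem ofReal_rpow_div {ρ r : ℝ} (hr : 0 < r) :
    ENNReal.ofReal (r ^ ρ / r) = ENNReal.ofReal (r ^ ρ) * (ENNReal.ofReal r)⁻¹ := by
  rw [div_eq_mul_inv, ENNReal.ofReal_mul (by positivity), ENNReal.ofReal_inv_of_pos hr]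

/-- `ofReal ((r^ρ)²/r²) = ofReal (r^{2ρ}) · (ofReal r ^ 2)⁻¹` for `r > 0`. [folklore] -/
private theorem ofReal_rpow_sq_div_sq {ρ r : ℝ} (hr : 0 < r) :
    ENNReal.ofReal ((r ^ ρ) ^ 2 / r ^ 2) =
      ENNReal.ofReal (r ^ (2 * ρ)) * (ENNReal.ofReal r ^ 2)⁻¹ := by
  rw [div_eq_mul_inv, ENNReal.ofReal_mul (by positivity), ← ENNReal.ofReal_pow hr.le,
    ENNReal.ofReal_inv_of_pos (by positivity), ← Real.rpow_natCast (r ^ ρ) 2,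
    ← Real.rpow_mul hr.le, mul_comm ρ]
  norm_num

/-- **The route's power-gauged bound implies Seregin's (1.7) with `f(r) = r^ρ`.** If
`r^{2ρ} A(r) + r^{ρ} E(r) + r^{2ρ} D(r) ≤ M` for all `r ∈ ]0, 1]` at the origin, with the CKN
quantities `cknA` (a genuine supremum in time), `cknE`, `cknD`, then
`HasWeightedEnergyBound (r ↦ r^ρ) M v q G` (`A_f + E_f + D_f ≤ M` on `]0,1[`, `A_f` the essential
supremum): `E_f = r^ρ E`, `D_f = r^{2ρ} D` identically and `A_f ≤ r^{2ρ} A` (`ess sup ≤ sup`).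
[cite: Seregin2026, (1.7) (p. 4)] -/
theorem hasWeightedEnergyBound_rpow_of_gauge {ρ : ℝ} {M : ℝ≥0}
    {v : ℝ → EuclideanSpace ℝ (Fin 3) → EuclideanSpace ℝ (Fin 3)}
    {q : ℝ → EuclideanSpace ℝ (Fin 3) → ℝ}
    {G : ℝ → EuclideanSpace ℝ (Fin 3) → EuclideanSpace ℝ (Fin 3) →L[ℝ] EuclideanSpace ℝ (Fin 3)}
    (hM : ∀ r ∈ Ioc (0 : ℝ) 1,
      ENNReal.ofReal (r ^ (2 * ρ)) * cknA r (0 : ℝ × EuclideanSpace ℝ (Fin 3)) v +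
          ENNReal.ofReal (r ^ ρ) * cknE r (0 : ℝ × EuclideanSpace ℝ (Fin 3)) G +
          ENNReal.ofReal (r ^ (2 * ρ)) * cknD r (0 : ℝ × EuclideanSpace ℝ (Fin 3)) q ≤ (M : ℝ≥0∞)) :
    HasWeightedEnergyBound (fun r => r ^ ρ) M v q G := by
  intro r hr
  have hr0 : 0 < r := hr.1
  have hA : weightedA (fun r => r ^ ρ) r (0 : ℝ × EuclideanSpace ℝ (Fin 3)) v ≤
      ENNReal.ofReal (r ^ (2 * ρ)) * cknA r (0 : ℝ × EuclideanSpace ℝ (Fin 3)) v := by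
    unfold weightedA cknA
    refine essSup_le_of_ae_le _ ?_
    filter_upwards [ae_restrict_mem measurableSet_Ioo] with t ht
    rw [ofReal_rpow_sq_div hr0, mul_assoc]
    gcongr
    exact le_iSup₂ (f := fun t (_ : t ∈ Ioo ((0 : ℝ × EuclideanSpace ℝ (Fin 3)).1 - r ^ 2)
      (0 : ℝ × EuclideanSpace ℝ (Fin 3)).1) =>
        (ENNReal.ofReal r)⁻¹ * ∫⁻ x in ball (0 : ℝ × EuclideanSpace ℝ (Fin 3)).2 r, ‖v t x‖ₑ ^ 2) t ht
  have hE : weightedE (fun r => r ^ ρ) r (0 : ℝ × EuclideanSpace ℝ (Fin 3)) G =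
      ENNReal.ofReal (r ^ ρ) * cknE r (0 : ℝ × EuclideanSpace ℝ (Fin 3)) G := by
    unfold weightedE cknE
    rw [ofReal_rpow_div hr0, mul_assoc]
  have hD : weightedD (fun r => r ^ ρ) r (0 : ℝ × EuclideanSpace ℝ (Fin 3)) q =
      ENNReal.ofReal (r ^ (2 * ρ)) * cknD r (0 : ℝ × EuclideanSpace ℝ (Fin 3)) q := by
    unfold weightedD cknD
    rw [ofReal_rpow_sq_div_sq hr0, mul_assoc]
  calc weightedA (fun r => r ^ ρ) r 0 v + weightedE (fun r => r ^ ρ) r 0 G +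
        weightedD (fun r => r ^ ρ) r 0 q
      ≤ ENNReal.ofReal (r ^ (2 * ρ)) * cknA r 0 v + ENNReal.ofReal (r ^ ρ) * cknE r 0 G +
          ENNReal.ofReal (r ^ (2 * ρ)) * cknD r 0 q := by
        rw [hE, hD]
        gcongr
    _ ≤ M := hM r ⟨hr.1, hr.2.le⟩

/-! ### (c) The floor (3.1): the route's space–time integral is Seregin's `f^{l-1} M̄` at `(3,3,2)` -/

/-- **`f(r)^{l-1} M̄^{3,3}_2(v, r) = r^{2ρ-2} ∫_{]t₀ - r^{2+ρ}, t₀[ × B(x₀, r)} |v|³`** for `f(r) = r^ρ`,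
`l = 3`, `r > 0` (Tonelli on the product window; `l/s = 1`, `r² f(r) = r^{2+ρ}`,
`r^{2ρ} r^{-2} = r^{2ρ-2}`), for `v` a.e.-strongly measurable on the window — the dictionary
between the floor (3.1) of the route decl and the hypothesis of
`seregin2026_typeII_scenario_eulerLimit`. [cite: Seregin2026, (3.1) and the display after it (p. 8)] -/
theorem rpow_mul_morreyMbar_rpow_eq {ρ r : ℝ} (hr : 0 < r) (z : ℝ × EuclideanSpace ℝ (Fin 3))
    (v : ℝ → EuclideanSpace ℝ (Fin 3) → EuclideanSpace ℝ (Fin 3))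
    (hmeas : AEStronglyMeasurable (uncurry v)
      (volume.restrict (Ioo (z.1 - r ^ (2 + ρ)) z.1 ×ˢ ball z.2 r))) :
    ENNReal.ofReal ((r ^ ρ) ^ ((3 : ℝ) - 1)) * morreyMbar (fun s => s ^ ρ) (kappa 3 3) 3 3 z v r =
      ENNReal.ofReal (r ^ (2 * ρ - 2)) *
        ∫⁻ w in Ioo (z.1 - r ^ (2 + ρ)) z.1 ×ˢ ball z.2 r, ‖v w.1 w.2‖ₑ ^ (3 : ℕ) := by
  have hwin : z.1 - r ^ 2 * r ^ ρ = z.1 - r ^ (2 + ρ) := by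
    rw [← Real.rpow_natCast r 2, ← Real.rpow_add hr]
    norm_num
  unfold morreyMbar
  rw [kappa_three_three, hwin, show ((3 : ℝ) / 3) = 1 by norm_num]
  simp only [ENNReal.rpow_one]
  -- Tonelli on the product window
  have hprod : (volume.restrict (Ioo (z.1 - r ^ (2 + ρ)) z.1 ×ˢ ball z.2 r) :
      Measure (ℝ × EuclideanSpace ℝ (Fin 3))) =
      (volume.restrict (Ioo (z.1 - r ^ (2 + ρ)) z.1)).prod (volume.restrict (ball z.2 r)) := by
    rw [Measure.prod_restrict, ← Measure.volume_eq_prod]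
  have hf : AEMeasurable (fun w : ℝ × EuclideanSpace ℝ (Fin 3) => ‖v w.1 w.2‖ₑ ^ (3 : ℕ))
      ((volume.restrict (Ioo (z.1 - r ^ (2 + ρ)) z.1)).prod (volume.restrict (ball z.2 r))) := by
    rw [← hprod]
    exact hmeas.enorm.pow_const 3
  have htonelli : ∫⁻ w in Ioo (z.1 - r ^ (2 + ρ)) z.1 ×ˢ ball z.2 r, ‖v w.1 w.2‖ₑ ^ (3 : ℕ) =
      ∫⁻ t in Ioo (z.1 - r ^ (2 + ρ)) z.1, ∫⁻ x in ball z.2 r, ‖v t x‖ₑ ^ (3 : ℝ) := by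
    rw [hprod, lintegral_prod _ hf]
    refine lintegral_congr fun t => lintegral_congr fun x => ?_
    exact (ENNReal.rpow_ofNat _ 3).symm
  rw [htonelli, ← mul_assoc, ← ENNReal.ofReal_mul (by positivity)]
  congr 1
  rw [← Real.rpow_mul hr.le, ← Real.rpow_add hr]
  norm_num
  ring_nf

/-- **From "small radii frequently" to a strictly decreasing null sequence.** If for every
`δ > 0` some `r ∈ ]0, δ[` has property `P`, then there is a strictly decreasing sequence
`r_k ∈ ]0, 1[`, `r_k → 0`, all of whose terms have property `P` (recursive choice with
`δ_{k+1} = min(r_k, 1/(k+2))`). The route decl states the floor (3.1) in the first form, Seregin's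
theorem (and `seregin2026_typeII_scenario_eulerLimit`) in the second. [folklore] -/
private theorem exists_seq_strictAnti_of_frequently {P : ℝ → Prop}
    (h : ∀ δ : ℝ, 0 < δ → ∃ r ∈ Ioo (0 : ℝ) δ, P r) :
    ∃ r : ℕ → ℝ, (∀ k, r k ∈ Ioo (0 : ℝ) 1) ∧ StrictAnti r ∧ Tendsto r atTop (𝓝 0) ∧
      ∀ k, P (r k) := by
  classical
  -- one step of the recursion: from a radius `x` and an index `k`, a radius in `]0, min(x,1/(k+2))[`
  -- with property `P` (junk `0` if `x ≤ 0`, never used)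
  let step : ℕ → ℝ → ℝ := fun k x =>
    if hx : 0 < x then (h (min x (1 / ((k : ℝ) + 2))) (lt_min hx (by positivity))).choose else 0
  have hstep : ∀ (k : ℕ) (x : ℝ), 0 < x →
      step k x ∈ Ioo (0 : ℝ) (min x (1 / ((k : ℝ) + 2))) ∧ P (step k x) := by
    intro k x hx
    have hs : step k x = (h (min x (1 / ((k : ℝ) + 2))) (lt_min hx (by positivity))).choose := by
      simp only [step, dif_pos hx]
    rw [hs]
    exact (h (min x (1 / ((k : ℝ) + 2))) (lt_min hx (by positivity))).choose_spec
  obtain ⟨r₀, hr₀, hP₀⟩ := h 1 one_pos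
  let r : ℕ → ℝ := fun n => Nat.rec r₀ (fun k x => step k x) n
  have hr_zero : r 0 = r₀ := rfl
  have hr_succ : ∀ k, r (k + 1) = step k (r k) := fun k => rfl
  -- positivity, by induction
  have hpos : ∀ k, 0 < r k := by
    intro k
    induction k with
    | zero => rw [hr_zero]; exact hr₀.1
    | succ k ih => rw [hr_succ]; exact (hstep k (r k) ih).1.1
  have hsucc : ∀ k, r (k + 1) < r k ∧ r (k + 1) < 1 / ((k : ℝ) + 2) ∧ P (r (k + 1)) := by
    intro k
    obtain ⟨hmem, hP⟩ := hstep k (r k) (hpos k)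
    rw [hr_succ]
    exact ⟨hmem.2.trans_le (min_le_left _ _), hmem.2.trans_le (min_le_right _ _), hP⟩
  have hanti : StrictAnti r := strictAnti_nat_of_succ_lt fun k => (hsucc k).1
  -- `r k ≤ 1/(k+1)`
  have hle : ∀ k, r k ≤ 1 / ((k : ℝ) + 1) := by
    intro k
    cases k with
    | zero => rw [hr_zero]; norm_num; exact hr₀.2.le
    | succ k =>
      have := (hsucc k).2.1
      push_cast
      rw [show (k : ℝ) + 1 + 1 = (k : ℝ) + 2 by ring]
      exact this.le
  refine ⟨r, fun k => ⟨hpos k, ?_⟩, hanti, ?_, fun k => ?_⟩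
  · exact (hanti.antitone (Nat.zero_le k)).trans_lt (by rw [hr_zero]; exact hr₀.2)
  · refine squeeze_zero (fun k => (hpos k).le) hle ?_
    exact tendsto_one_div_add_atTop_nhds_zero_nat
  · cases k with
    | zero => rw [hr_zero]; exact hP₀
    | succ k => exact (hsucc k).2.2

/-- **The floor (3.1) of the route decl, rewritten as the hypothesis of
`seregin2026_typeII_scenario_eulerLimit` at `(s, l, κ) = (3, 3, 2)`, `f = r^ρ`** (centre `z`):
from `∀ δ > 0, ∃ r ∈ ]0,δ[, ε₀ ≤ r^{2ρ-2} ∫_{]t₀-r^{2+ρ},t₀[ × B(x₀,r)} |v|³` one gets a strictly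
decreasing sequence `r_k ∈ ]0,1[`, `r_k → 0`, with `ε₀ ≤ f(r_k)^{l-1} M̄^{3,3}_2(v, r_k)` for all `k`
(for `v` a.e.-strongly measurable on the windows). [cite: Seregin2026, (3.1) (p. 8)] -/
theorem exists_floor_seq {ρ ε₀ : ℝ} (z : ℝ × EuclideanSpace ℝ (Fin 3))
    (v : ℝ → EuclideanSpace ℝ (Fin 3) → EuclideanSpace ℝ (Fin 3))
    (hmeas : ∀ r : ℝ, 0 < r → AEStronglyMeasurable (uncurry v)
      (volume.restrict (Ioo (z.1 - r ^ (2 + ρ)) z.1 ×ˢ ball z.2 r)))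
    (hfloor : ∀ δ : ℝ, 0 < δ → ∃ r ∈ Ioo (0 : ℝ) δ,
      ENNReal.ofReal ε₀ ≤ ENNReal.ofReal (r ^ (2 * ρ - 2)) *
        ∫⁻ w in Ioo (z.1 - r ^ (2 + ρ)) z.1 ×ˢ ball z.2 r, ‖v w.1 w.2‖ₑ ^ (3 : ℕ)) :
    ∃ r : ℕ → ℝ, (∀ k, r k ∈ Ioo (0 : ℝ) 1) ∧ StrictAnti r ∧ Tendsto r atTop (𝓝 0) ∧
      ∀ k, ENNReal.ofReal ε₀ ≤
        ENNReal.ofReal ((r k ^ ρ) ^ ((3 : ℝ) - 1)) *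
          morreyMbar (fun s => s ^ ρ) (kappa 3 3) 3 3 z v (r k) := by
  obtain ⟨r, hr, hanti, hlim, hP⟩ := exists_seq_strictAnti_of_frequently hfloor
  refine ⟨r, hr, hanti, hlim, fun k => ?_⟩
  rw [rpow_mul_morreyMbar_rpow_eq (hr k).1 z v (hmeas (r k) (hr k).1)]
  exact hP k

/-! ### (f) Non-triviality: `M^{3,3}_2(u, 1) ≥ ε₀/2 > 0` forbids `u = 0` a.e. on `]-∞,0[ × ℝ³` -/

/-- **Seregin's non-triviality (3.8) gives the route's `¬ (u = 0 a.e.)`.** If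
`M^{3,3}_2(u, 1) = ∫_{-1}^{0} ∫_{B(1)} |u|³ ≥ ε₀/2` with `ε₀ > 0`, then `u` is not a.e. zero on the
slab `]-∞, 0[ × ℝ³` (if it were, a.e. slice would vanish a.e. on the unit ball and the iterated
integral would be `0`). [cite: Seregin2026, (3.8) (p. 9)] -/
theorem not_ae_eq_zero_of_morreyM_ge {ε₀ : ℝ} (hε₀ : 0 < ε₀)
    {u : ℝ → EuclideanSpace ℝ (Fin 3) → EuclideanSpace ℝ (Fin 3)}
    (h : ENNReal.ofReal (ε₀ / 2) ≤ morreyM (kappa 3 3) 3 3 (0 : ℝ × EuclideanSpace ℝ (Fin 3)) u 1) :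
    ¬ (Function.uncurry u =ᵐ[volume.restrict (Iio (0 : ℝ) ×ˢ (univ : Set (EuclideanSpace ℝ (Fin 3))))] 0) := by
  intro hae
  -- slice-wise: for a.e. `t < 0`, `u t = 0` a.e.
  have hprod : (volume.restrict (Iio (0 : ℝ) ×ˢ (univ : Set (EuclideanSpace ℝ (Fin 3)))) :
      Measure (ℝ × EuclideanSpace ℝ (Fin 3))) =
      (volume.restrict (Iio (0 : ℝ))).prod
        (volume.restrict (univ : Set (EuclideanSpace ℝ (Fin 3)))) := by
    rw [Measure.prod_restrict, ← Measure.volume_eq_prod]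
  rw [hprod] at hae
  have hslice : ∀ᵐ t ∂(volume.restrict (Iio (0 : ℝ))),
      ∀ᵐ x ∂(volume.restrict (univ : Set (EuclideanSpace ℝ (Fin 3)))), u t x = 0 := by
    have h2 := Measure.ae_ae_of_ae_prod hae
    filter_upwards [h2] with t ht
    filter_upwards [ht] with x hx
    simpa using hx
  -- hence the inner integrals vanish for a.e. `t ∈ ]-1, 0[`
  have hinner : ∀ᵐ t ∂(volume.restrict (Ioo ((0 : ℝ × EuclideanSpace ℝ (Fin 3)).1 - 1 ^ 2)
      (0 : ℝ × EuclideanSpace ℝ (Fin 3)).1)),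
      (∫⁻ x in ball (0 : ℝ × EuclideanSpace ℝ (Fin 3)).2 1, ‖u t x‖ₑ ^ (3 : ℝ)) ^ ((3 : ℝ) / 3)
        = 0 := by
    have hsub : Ioo ((0 : ℝ × EuclideanSpace ℝ (Fin 3)).1 - 1 ^ 2)
        (0 : ℝ × EuclideanSpace ℝ (Fin 3)).1 ⊆ Iio (0 : ℝ) := fun t ht => ht.2
    filter_upwards [ae_restrict_of_ae_restrict_of_subset hsub hslice] with t ht
    rw [Measure.restrict_univ] at ht
    have hzero : ∫⁻ x in ball (0 : ℝ × EuclideanSpace ℝ (Fin 3)).2 1, ‖u t x‖ₑ ^ (3 : ℝ) = 0 := by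
      refine (lintegral_congr_ae (ae_restrict_of_ae ?_)).trans lintegral_zero
      filter_upwards [ht] with x hx
      simp [hx, ENNReal.zero_rpow_of_pos (by norm_num : (0 : ℝ) < 3)]
    rw [hzero, ENNReal.zero_rpow_of_pos (by norm_num)]
  have hM : morreyM (kappa 3 3) 3 3 (0 : ℝ × EuclideanSpace ℝ (Fin 3)) u 1 = 0 := by
    unfold morreyM
    rw [lintegral_congr_ae hinner, lintegral_zero, mul_zero]
  rw [hM, nonpos_iff_eq_zero, ENNReal.ofReal_eq_zero] at h
  linarith

end Literature.Analysis.FluidPDE.Seregin2023
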